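import Literature.Probability.Percolation.NestingPhaseEstimates
import Literature.Probability.Percolation.NestingWeightMeasurable
import Literature.Probability.Percolation.SiteNestingWeightBound
import Literature.Probability.Percolation.FKLoopNestingIntegrable
import HarnessLib

/-!
# The lattice nesting weights (site `δ𝕋`, bond `δℤ²`) are bounded and integrable at positive mesh

Assembly of `SiteNestingWeightBound` (finitely many loops of `siteLoopConfig δ ω` meet a ball,
`ncard_loops_siteLoopConfig_meeting_le`), `NestingPhaseEstimates` (loops missing the ball carrying
the density contribute the factor `1`, `nestingFactor_eq_one_of_disjoint`) and
`NestingWeightMeasurable` (`measurable_nestingWeight_siteLoopConfig`): for a density `f` with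
`|f| ≤ C`, `f = 0` off `B̄(0, R)`, `∫ f = 0`, and every mesh `δ > 0`,

* `abs_nestingWeight_siteLoopConfig_le` — `|A_f(siteLoopConfig δ ω)| ≤ 2^{N(δ,R)}` for every `ω`,
  and the same for the truncated functional `A^ε_f` (`abs_truncNestingWeight_siteLoopConfig_le`);
* `integrable_nestingWeight_siteLoopConfig`, `integrable_truncNestingWeight_siteLoopConfig` —
  both are integrable for every finite measure on `SiteConfig (Site 2)`; in particular the
  expectations `Λ^𝕋_δ(f)`, `Λ^{𝕋,≥ε}_δ(f)` in `MagicFormulaT` / `TransferContinuity`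
  (route `CardyMagicRigidity`) and in `truncNestingTransform (triSitePercolation half)
  (siteLoopConfig δ)` are honest finite Lebesgue integrals.

* the bond-`ℤ²` analogues for DENSITY test functions and the truncated functional
  (`abs_truncNestingWeight_bondLoopConfig_le`, `integrable_truncNestingWeight_bondLoopConfig`,
  `abs_truncNestingTransform_bondLoopConfig_le`; the untruncated signed-measure versions are
  `abs_loopNestingWeight_le` / `integrable_loopNestingWeight` of `FKLoopNestingIntegrable`).

So all four families of expectations in the hypotheses (Z), (T), (B) of the reduction of
`TransferContinuity` (`Summits/…/CardyMagicRigidityTransferContinuityReduction.lean`) are finite.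

## References

* H. Duminil-Copin, K. K. Kozlowski, P. Lammers, I. Manolescu, arXiv:2603.06268 (2026), §3.2,
  (5.4) ("whenever the infinite product is well-defined").
* F. Camia, C. M. Newman, Comm. Math. Phys. 268 (2006), §2.
-/

noncomputable section

open MeasureTheory Set Filter Metric Function
open scoped Real Topology

namespace Literature.Probability.Percolation

open LatticeModels RandomPlanarGeometry

variable {f : ℂ → ℝ} {R : ℝ}

/-- **A `finprod` of factors of modulus `≤ 2` over a set whose contributing members lie in a
finite set of cardinality `≤ N` has modulus `≤ 2 ^ N`.** [folklore] -/
theorem abs_finprod_mem_le_two_pow {α : Type*} {S : Set α} {g : α → ℝ} (hg : ∀ a, |g a| ≤ 2)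
    {T : Set α} (hT : T.Finite) (hsupp : S ∩ mulSupport g ⊆ T) {N : ℕ} (hN : T.ncard ≤ N) :
    |∏ᶠ a ∈ S, g a| ≤ 2 ^ N := by
  classical
  have hAfin : (S ∩ mulSupport g).Finite := hT.subset hsupp
  rw [finprod_mem_eq_prod g hAfin, Finset.abs_prod]
  calc ∏ a ∈ hAfin.toFinset, |g a| ≤ ∏ _a ∈ hAfin.toFinset, (2 : ℝ) :=
        Finset.prod_le_prod (fun a _ ↦ abs_nonneg _) fun a _ ↦ hg a
    _ = 2 ^ hAfin.toFinset.card := Finset.prod_const _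
    _ ≤ 2 ^ N := by
        refine pow_le_pow_right₀ one_le_two ?_
        rw [← Set.ncard_eq_toFinset_card _ hAfin]
        exact (Set.ncard_le_ncard hsupp hT).trans hN

/-- **Uniform bound on the site-`𝕋` nesting weight at positive mesh**: for `f = 0` off `B̄(0, R)`
with `∫ f = 0` and `δ > 0`, `|A_f(siteLoopConfig δ ω)| ≤ 2^{N(δ,R)}` for every configuration,
`N(δ, R)` the number of faces of `ncard_loops_siteLoopConfig_meeting_le`: only the (at most `N`)
loops meeting the ball contribute (`range_inter_closedBall_nonempty_of_nestingFactor_ne_one`),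
each by a factor of modulus `≤ 2`. [cite: DuminilCopinKozlowskiLammersManolescu2026, (5.4)] -/
theorem abs_nestingWeight_siteLoopConfig_le (hR : ∀ z, R < ‖z‖ → f z = 0) (h0 : ∫ z, f z = 0)
    {δ : ℝ} (hδ : 0 < δ) (ω : SiteConfig (Site 2)) :
    |(siteLoopConfig δ ω).nestingWeight f| ≤
      2 ^ (finite_setOf_norm_hexCenter_le hδ (R + 2 * δ)).toFinset.card := by
  obtain ⟨hfin, hcard⟩ := ncard_loops_siteLoopConfig_meeting_le hδ R ω
  refine abs_finprod_mem_le_two_pow (fun u ↦ UnbasedLoop.abs_nestingFactor_le f u) hfin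
    (fun u hu ↦ ⟨hu.1, ?_⟩) hcard
  exact range_inter_closedBall_nonempty_of_nestingFactor_ne_one hR h0 hu.2

/-- The same bound for the truncated functional `A^ε_f(siteLoopConfig δ ω)` (fewer loops).
[cite: DuminilCopinKozlowskiLammersManolescu2026, §5 p. 37] -/
theorem abs_truncNestingWeight_siteLoopConfig_le (hR : ∀ z, R < ‖z‖ → f z = 0) (h0 : ∫ z, f z = 0)
    {δ : ℝ} (hδ : 0 < δ) (ε : ℝ) (ω : SiteConfig (Site 2)) :
    |(siteLoopConfig δ ω).truncNestingWeight f ε| ≤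
      2 ^ (finite_setOf_norm_hexCenter_le hδ (R + 2 * δ)).toFinset.card := by
  obtain ⟨hfin, hcard⟩ := ncard_loops_siteLoopConfig_meeting_le hδ R ω
  refine abs_finprod_mem_le_two_pow (fun u ↦ UnbasedLoop.abs_nestingFactor_le f u) hfin
    (fun u hu ↦ ⟨hu.1.1, ?_⟩) hcard
  exact range_inter_closedBall_nonempty_of_nestingFactor_ne_one hR h0 hu.2

/-- **The site-`𝕋` nesting weight is integrable at positive mesh** for every finite measure on
configurations: measurable (`measurable_nestingWeight_siteLoopConfig`) and uniformly bounded
(`abs_nestingWeight_siteLoopConfig_le`). In particular `Λ^𝕋_δ(f)` in `MagicFormulaT` is an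
honest finite Lebesgue integral. [cite: DuminilCopinKozlowskiLammersManolescu2026, (5.4)] -/
theorem integrable_nestingWeight_siteLoopConfig (hR : ∀ z, R < ‖z‖ → f z = 0) (h0 : ∫ z, f z = 0)
    {δ : ℝ} (hδ : 0 < δ) (P : Measure (SiteConfig (Site 2))) [IsFiniteMeasure P] :
    Integrable (fun ω ↦ (siteLoopConfig δ ω).nestingWeight f) P := by
  refine Integrable.mono' (integrable_const ((2 : ℝ) ^
      (finite_setOf_norm_hexCenter_le hδ (R + 2 * δ)).toFinset.card))
    (measurable_nestingWeight_siteLoopConfig f δ).aestronglyMeasurable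
    (Eventually.of_forall fun ω ↦ ?_)
  rw [Real.norm_eq_abs]
  exact abs_nestingWeight_siteLoopConfig_le hR h0 hδ ω

/-- **The truncated site-`𝕋` nesting weight is integrable at positive mesh** (so
`truncNestingTransform (triSitePercolation half) (siteLoopConfig δ) f ε` is an honest integral).
[cite: DuminilCopinKozlowskiLammersManolescu2026, §5 p. 37] -/
theorem integrable_truncNestingWeight_siteLoopConfig (hR : ∀ z, R < ‖z‖ → f z = 0)
    (h0 : ∫ z, f z = 0) {δ : ℝ} (hδ : 0 < δ) (ε : ℝ) (P : Measure (SiteConfig (Site 2)))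
    [IsFiniteMeasure P] :
    Integrable (fun ω ↦ (siteLoopConfig δ ω).truncNestingWeight f ε) P := by
  refine Integrable.mono' (integrable_const ((2 : ℝ) ^
      (finite_setOf_norm_hexCenter_le hδ (R + 2 * δ)).toFinset.card))
    (measurable_truncNestingWeight_siteLoopConfig f ε δ).aestronglyMeasurable
    (Eventually.of_forall fun ω ↦ ?_)
  rw [Real.norm_eq_abs]
  exact abs_truncNestingWeight_siteLoopConfig_le hR h0 hδ ε ω

/-- The expectations are bounded by the same constant: `|Λ^{𝕋,≥ε}_δ(f)| ≤ 2^{N(δ,R)} · P(Ω)`.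
[cite: DuminilCopinKozlowskiLammersManolescu2026, §5 p. 37] -/
theorem abs_truncNestingTransform_siteLoopConfig_le (hR : ∀ z, R < ‖z‖ → f z = 0)
    (h0 : ∫ z, f z = 0) {δ : ℝ} (hδ : 0 < δ) (ε : ℝ) (P : Measure (SiteConfig (Site 2)))
    [IsFiniteMeasure P] :
    |truncNestingTransform P (siteLoopConfig δ) f ε| ≤
      2 ^ (finite_setOf_norm_hexCenter_le hδ (R + 2 * δ)).toFinset.card * P.real Set.univ := by
  rw [truncNestingTransform]
  calc |∫ ω, (siteLoopConfig δ ω).truncNestingWeight f ε ∂P|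
      = ‖∫ ω, (siteLoopConfig δ ω).truncNestingWeight f ε ∂P‖ := (Real.norm_eq_abs _).symm
    _ ≤ 2 ^ (finite_setOf_norm_hexCenter_le hδ (R + 2 * δ)).toFinset.card * P.real Set.univ := by
        refine norm_integral_le_of_norm_le_const (Eventually.of_forall fun ω ↦ ?_)
        rw [Real.norm_eq_abs]
        exact abs_truncNestingWeight_siteLoopConfig_le hR h0 hδ ε ω

/-! ### Bond percolation on `δℤ²`: the same bounds for density test functions -/

/-- **Uniform bound on the bond-`ℤ²` nesting weight of a density at positive mesh**:
`|A_f(bondLoopConfig δ 0 ω)| ≤ 2^{N(δ,R)}` with `N(δ, R)` the corner count of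
`ncard_loops_meeting_le` (the density form of `abs_loopNestingWeight_le`).
[cite: DuminilCopinKozlowskiLammersManolescu2026, (5.4)] -/
theorem abs_nestingWeight_bondLoopConfig_le (hR : ∀ z, R < ‖z‖ → f z = 0) (h0 : ∫ z, f z = 0)
    {δ : ℝ} (hδ : 0 < δ) (ω : BondConfig (Site 2)) :
    |(bondLoopConfig δ 0 ω).nestingWeight f| ≤
      2 ^ (finite_setOf_corner_norm_le hδ (R + |δ|)).toFinset.card := by
  obtain ⟨hfin, hcard⟩ := ncard_loops_meeting_le hδ R ω
  refine abs_finprod_mem_le_two_pow (fun u ↦ UnbasedLoop.abs_nestingFactor_le f u) hfin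
    (fun u hu ↦ ⟨hu.1, ?_⟩) hcard
  exact range_inter_closedBall_nonempty_of_nestingFactor_ne_one hR h0 hu.2

/-- The same bound for the truncated functional `A^ε_f(bondLoopConfig δ 0 ω)`.
[cite: DuminilCopinKozlowskiLammersManolescu2026, §5 p. 37] -/
theorem abs_truncNestingWeight_bondLoopConfig_le (hR : ∀ z, R < ‖z‖ → f z = 0) (h0 : ∫ z, f z = 0)
    {δ : ℝ} (hδ : 0 < δ) (ε : ℝ) (ω : BondConfig (Site 2)) :
    |(bondLoopConfig δ 0 ω).truncNestingWeight f ε| ≤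
      2 ^ (finite_setOf_corner_norm_le hδ (R + |δ|)).toFinset.card := by
  obtain ⟨hfin, hcard⟩ := ncard_loops_meeting_le hδ R ω
  refine abs_finprod_mem_le_two_pow (fun u ↦ UnbasedLoop.abs_nestingFactor_le f u) hfin
    (fun u hu ↦ ⟨hu.1.1, ?_⟩) hcard
  exact range_inter_closedBall_nonempty_of_nestingFactor_ne_one hR h0 hu.2

/-- **The (truncated) bond-`ℤ²` nesting weight of a density is integrable at positive mesh** for
every finite measure (`measurable_truncNestingWeight_bondLoopConfig` + the uniform bound); so
`truncNestingTransform (bondPercolation (zdGraph 2) half) (bondLoopConfig δ 0) f ε` is an honest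
integral for every cut-off `ε` (for `ε ≤ 0` it is the untruncated transform).
[cite: DuminilCopinKozlowskiLammersManolescu2026, §5 p. 37] -/
theorem integrable_truncNestingWeight_bondLoopConfig (hR : ∀ z, R < ‖z‖ → f z = 0)
    (h0 : ∫ z, f z = 0) {δ : ℝ} (hδ : 0 < δ) (ε : ℝ) (P : Measure (BondConfig (Site 2)))
    [IsFiniteMeasure P] :
    Integrable (fun ω ↦ (bondLoopConfig δ 0 ω).truncNestingWeight f ε) P := by
  refine Integrable.mono' (integrable_const ((2 : ℝ) ^
      (finite_setOf_corner_norm_le hδ (R + |δ|)).toFinset.card))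
    (measurable_truncNestingWeight_bondLoopConfig f ε δ).aestronglyMeasurable
    (Eventually.of_forall fun ω ↦ ?_)
  rw [Real.norm_eq_abs]
  exact abs_truncNestingWeight_bondLoopConfig_le hR h0 hδ ε ω

/-- `|Λ^{ℤ²,≥ε}_δ(f)| ≤ 2^{N(δ,R)} · P(Ω)`. [cite: DuminilCopinKozlowskiLammersManolescu2026, §5 p. 37] -/
theorem abs_truncNestingTransform_bondLoopConfig_le (hR : ∀ z, R < ‖z‖ → f z = 0)
    (h0 : ∫ z, f z = 0) {δ : ℝ} (hδ : 0 < δ) (ε : ℝ) (P : Measure (BondConfig (Site 2)))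
    [IsFiniteMeasure P] :
    |truncNestingTransform P (bondLoopConfig δ 0) f ε| ≤
      2 ^ (finite_setOf_corner_norm_le hδ (R + |δ|)).toFinset.card * P.real Set.univ := by
  rw [truncNestingTransform]
  calc |∫ ω, (bondLoopConfig δ 0 ω).truncNestingWeight f ε ∂P|
      = ‖∫ ω, (bondLoopConfig δ 0 ω).truncNestingWeight f ε ∂P‖ := (Real.norm_eq_abs _).symm
    _ ≤ 2 ^ (finite_setOf_corner_norm_le hδ (R + |δ|)).toFinset.card * P.real Set.univ := by
        refine norm_integral_le_of_norm_le_const (Eventually.of_forall fun ω ↦ ?_)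
        rw [Real.norm_eq_abs]
        exact abs_truncNestingWeight_bondLoopConfig_le hR h0 hδ ε ω

end Literature.Probability.Percolation

end
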